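import Summits.NavierStokesRegularity.NavierStokesRegularity.Theorems.PoloidalWindowDoorPoloidalWindowRigidityWindow
import Summits.NavierStokesRegularity.NavierStokesRegularity.Theorems.SqueezeCycleNoApexTypeIProfileTypeIBoundIdle
import Summits.NavierStokesRegularity.NavierStokesRegularity.Theorems.RellichScarApexLocalisationIrrotHalfspaceLiouville
import Literature.Analysis.FluidPDE.SelfSimilar
import Literature.Analysis.FluidPDE.LocalTypeI
import Literature.Analysis.FluidPDE.TypeIAncientMild
import Literature.Analysis.FluidPDE.TypeIAncientMildDecay
import Literature.Analysis.FluidPDE.TaoEnstrophyLocalisation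
import Literature.Analysis.Calculus.DifferenceQuotientHolder
import Literature.Analysis.UnboundedOperators.HeatExtensionUniformTail
import HarnessLib

/-!
# nsreg-p1 ROUND-17 door S18 «LocalConicalFinalStateDoor» (STAGED, HOLD) — the BC5 RUNG «zero-scar apex rigidity»
# (the `w₁ = 0` case of the crux K2 `ConicalApexRigidity`), PROVED — tree landing of the planner's sorry-free file

Statement (text of `ZeroScarApexRigidity` of nsreg-p1 `r17/Sketch18.lean` / `route-conical/bc/ConicalApexRigidity_rung.lean`,
verbatim): a door-class profile (Type-I time rate, Type-I space–time decay, continuity on the open backward slab,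
unit-viscosity Oseen–Duhamel identity, divergence-free slices) with the cubic contact `‖v(t,y)‖ ≤ K(−t)/‖y‖³` off the
apex is NOT backward-singular at the origin.  In the planner's K2 skeleton `zeroScar_of_conical : ConicalApexRigidity →
ZeroScarApexRigidity` is proved, so this is the BC5 witness «C decided where S is not» for a future S18 birth.

Proof (nsreg-p1 g15, `bc/ConicalApexRigidity_rung.lean` fa28fcb59f01b8ed, farm rc 0 / 0 sorry; landed here verbatim up to
the namespace — planners do not write `Theorems/`): the door class lies in `IsTypeIAncientMild`
(`isTypeIAncientMild_of_class`) with a common constant, so the Riesz pressure makes it an Albritton–Barker slab profile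
with `𝐈 < ∞` (`NoApexKNSS.exists_pressure_typeIBound_lt_top`), and every slice carries the Pineau–Vicol second-derivative
envelope `‖D²v(t,·)(y)‖ ≤ K₂ · max{‖y‖, √(−t)}⁻³` (`IsTypeIAncientMild.exists_forall_norm_iteratedFDeriv_le_of_hasTypeIDecay`);
ONE-SIDED LANDAU INTERPOLATION along segments of length `ε = √(−t)` (`norm_fderiv_apply_le_of_segment`,
`opNorm_fderiv_le_of_closedBall`) turns the cubic contact into `‖Dv(t,x)‖ ≤ (16K⁺/r³ + 8K₂/r³)√(−t) → 0` locally
uniformly off the apex, hence `curl v(t,·) → 0` there (`norm_curl_le`); the PROVED S15 representation theorem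
`…RellichScarApexLocalisationIrrotHalfspaceLiouville.not_isBackwardSingularPoint_of_topCurlVanishing_halfspace` ends.

Seat nsreg-p6 g10 (THEOREMS-ONLY door sequels, DIRECTOR-NS g8 #32 (2)/#36); credit: statement and proof nsreg-p1 g15.
WHAT THIS IS NOT: not NS regularity; not K2 `ConicalApexRigidity` (OPEN: its line is the apex backward-uniqueness
statement `stub_exteriorDifferenceBU`); no route is opened (S18 is staged, HOLD).
-/

noncomputable section

-- the summit and its single sub-problem share the name (CONVENTIONS §1)
set_option linter.dupNamespace false

namespace Summit.NavierStokesRegularity.NavierStokesRegularity.Theorems.LocalConicalFinalStateDoorZeroScarRung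

open MeasureTheory Set Function Filter Topology Metric
open scoped RealInnerProductSpace InnerProductSpace NNReal ENNReal
open Literature.Analysis Literature.Analysis.FluidPDE
open Literature.Analysis.UnboundedOperators (heatExtension)
open Summit.NavierStokesRegularity.NavierStokesRegularity.Theorems
open Summit.NavierStokesRegularity.NavierStokesRegularity.Theorems.PoloidalWindowDoorPoloidalWindowRigidityWindow
open Summit.NavierStokesRegularity.NavierStokesRegularity.Theorems.RellichScarApexLocalisationIrrotHalfspaceLiouville
  (not_isBackwardSingularPoint_of_topCurlVanishing_halfspace)
open Summit.NavierStokesRegularity.NavierStokesRegularity.Theorems.NoApexKNSS (exists_pressure_typeIBound_lt_top)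
open Literature.Analysis.Calculus (norm_fderiv_fderiv_le_norm_iteratedFDeriv_two)


/-! ## Calculus: one-sided second-order interpolation along a segment (vector-valued Landau) -/

/-- **Second-order one-sided Taylor bound along a segment.**  For `f ∈ C²((EuclideanSpace ℝ (Fin 3)); (EuclideanSpace ℝ (Fin 3)))`:
`‖Df(x)h‖ ≤ ‖f(x)‖ + ‖f(x+h)‖ + S‖h‖²` whenever `‖D²f‖ ≤ S` on the segment `[x, x+h]`
(two applications of the mean value inequality). [folklore] -/
theorem norm_fderiv_apply_le_of_segment {f : (EuclideanSpace ℝ (Fin 3)) → (EuclideanSpace ℝ (Fin 3))} (hf : ContDiff ℝ 2 f) (x h : (EuclideanSpace ℝ (Fin 3))) {A S : ℝ}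
    (h0 : ‖f x‖ ≤ A) (h1 : ‖f (x + h)‖ ≤ A)
    (hS : ∀ τ ∈ Icc (0 : ℝ) 1, ‖iteratedFDeriv ℝ 2 f (x + τ • h)‖ ≤ S) :
    ‖fderiv ℝ f x h‖ ≤ 2 * A + S * ‖h‖ ^ 2 := by
  have hd1 : Differentiable ℝ f := hf.differentiable (by norm_num)
  have hf1 : ContDiff ℝ 1 (fderiv ℝ f) := hf.fderiv_right (m := 1) (by norm_num)
  have hd2 : Differentiable ℝ (fderiv ℝ f) := hf1.differentiable (by norm_num)
  have hpath : ∀ τ : ℝ, HasDerivAt (fun σ : ℝ => x + σ • h) h τ := fun τ => by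
    simpa using ((hasDerivAt_id τ).smul_const h).const_add x
  -- `σ ↦ Df(x + σh) h` has derivative `D²f(x + σh)(h, h)`
  have hg : ∀ σ : ℝ, HasDerivAt (fun σ : ℝ => fderiv ℝ f (x + σ • h) h)
      (fderiv ℝ (fderiv ℝ f) (x + σ • h) h h) σ := by
    intro σ
    have hc : HasDerivAt (fun σ : ℝ => fderiv ℝ f (x + σ • h))
        (fderiv ℝ (fderiv ℝ f) (x + σ • h) h) σ :=
      (hd2 _).hasFDerivAt.comp_hasDerivAt σ (hpath σ)
    simpa using hc.clm_apply (hasDerivAt_const σ h)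
  -- step 1: `‖Df(x+τh)h − Df(x)h‖ ≤ S‖h‖²` on `[0,1]`
  have hS0 : 0 ≤ S := le_trans (norm_nonneg _) (hS 0 ⟨le_rfl, zero_le_one⟩)
  have hstep1 : ∀ τ ∈ Icc (0 : ℝ) 1,
      ‖fderiv ℝ f (x + τ • h) h - fderiv ℝ f (x + (0 : ℝ) • h) h‖ ≤ S * ‖h‖ ^ 2 * (τ - 0) := by
    intro τ hτ
    refine norm_image_sub_le_of_norm_deriv_le_segment' (f := fun σ : ℝ => fderiv ℝ f (x + σ • h) h)
      (f' := fun σ => fderiv ℝ (fderiv ℝ f) (x + σ • h) h h) (a := 0) (b := τ)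
      (fun σ _ => (hg σ).hasDerivWithinAt) (fun σ hσ => ?_) τ (right_mem_Icc.2 hτ.1)
    have hσ1 : σ ∈ Icc (0 : ℝ) 1 := ⟨hσ.1, hσ.2.le.trans hτ.2⟩
    calc ‖fderiv ℝ (fderiv ℝ f) (x + σ • h) h h‖
        ≤ ‖fderiv ℝ (fderiv ℝ f) (x + σ • h)‖ * ‖h‖ * ‖h‖ :=
          (fderiv ℝ (fderiv ℝ f) (x + σ • h)).le_opNorm₂ h h
      _ ≤ ‖iteratedFDeriv ℝ 2 f (x + σ • h)‖ * ‖h‖ * ‖h‖ := by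
          gcongr
          exact norm_fderiv_fderiv_le_norm_iteratedFDeriv_two f _
      _ ≤ S * ‖h‖ * ‖h‖ := by gcongr; exact hS σ hσ1
      _ = S * ‖h‖ ^ 2 := by ring
  -- step 2: `ψ σ := f(x + σh) − σ • Df(x)h` has `‖ψ′‖ ≤ S‖h‖²`, so `‖ψ 1 − ψ 0‖ ≤ S‖h‖²`
  have hψ : ∀ σ : ℝ, HasDerivAt (fun σ : ℝ => f (x + σ • h) - σ • fderiv ℝ f x h)
      (fderiv ℝ f (x + σ • h) h - fderiv ℝ f x h) σ := fun σ => by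
    have hc : HasDerivAt (fun σ : ℝ => f (x + σ • h)) (fderiv ℝ f (x + σ • h) h) σ :=
      (hd1 _).hasFDerivAt.comp_hasDerivAt σ (hpath σ)
    have hl : HasDerivAt (fun σ : ℝ => σ • fderiv ℝ f x h) (fderiv ℝ f x h) σ := by
      simpa using (hasDerivAt_id σ).smul_const (fderiv ℝ f x h)
    exact hc.sub hl
  have hmvt := norm_image_sub_le_of_norm_deriv_le_segment'
    (f := fun σ : ℝ => f (x + σ • h) - σ • fderiv ℝ f x h)
    (f' := fun σ => fderiv ℝ f (x + σ • h) h - fderiv ℝ f x h) (a := 0) (b := 1) (C := S * ‖h‖ ^ 2)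
    (fun σ _ => (hψ σ).hasDerivWithinAt) (fun σ hσ => by
      have hst := hstep1 σ ⟨hσ.1, hσ.2.le⟩
      rw [zero_smul, add_zero] at hst
      refine hst.trans ?_
      calc S * ‖h‖ ^ 2 * (σ - 0) ≤ S * ‖h‖ ^ 2 * 1 :=
            mul_le_mul_of_nonneg_left (by linarith [hσ.2]) (mul_nonneg hS0 (sq_nonneg _))
        _ = S * ‖h‖ ^ 2 := mul_one _) 1 (right_mem_Icc.2 zero_le_one)
  have hrem : ‖f (x + h) - fderiv ℝ f x h - f x‖ ≤ S * ‖h‖ ^ 2 := by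
    simpa only [one_smul, zero_smul, add_zero, sub_zero, mul_one] using hmvt
  calc ‖fderiv ℝ f x h‖ = ‖(f (x + h) - f x) - (f (x + h) - fderiv ℝ f x h - f x)‖ := by
        congr 1; abel
    _ ≤ ‖f (x + h) - f x‖ + ‖f (x + h) - fderiv ℝ f x h - f x‖ := norm_sub_le _ _
    _ ≤ (‖f (x + h)‖ + ‖f x‖) + S * ‖h‖ ^ 2 := add_le_add (norm_sub_le _ _) hrem
    _ ≤ 2 * A + S * ‖h‖ ^ 2 := by linarith

/-- **Operator-norm interpolation on a ball**: `‖f‖ ≤ A` and `‖D²f‖ ≤ S` on `B̄(x, ε)`, `ε > 0`, give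
`‖Df(x)‖ ≤ 2A/ε + S ε` (Landau's one-sided inequality, vector-valued, before optimising `ε`). [folklore] -/
theorem opNorm_fderiv_le_of_closedBall {f : (EuclideanSpace ℝ (Fin 3)) → (EuclideanSpace ℝ (Fin 3))} (hf : ContDiff ℝ 2 f) (x : (EuclideanSpace ℝ (Fin 3))) {ε A S : ℝ}
    (hε : 0 < ε) (hA : 0 ≤ A) (hS0 : 0 ≤ S)
    (h0 : ∀ z ∈ closedBall x ε, ‖f z‖ ≤ A) (h2 : ∀ z ∈ closedBall x ε, ‖iteratedFDeriv ℝ 2 f z‖ ≤ S) :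
    ‖fderiv ℝ f x‖ ≤ 2 * A / ε + S * ε := by
  refine ContinuousLinearMap.opNorm_le_bound _ (by positivity) fun k => ?_
  by_cases hk : k = 0
  · simp [hk]
  have hkn : 0 < ‖k‖ := norm_pos_iff.2 hk
  obtain ⟨h, hh_def⟩ : ∃ h : (EuclideanSpace ℝ (Fin 3)), h = (ε / ‖k‖) • k := ⟨_, rfl⟩
  have hh : ‖h‖ = ε := by
    rw [hh_def, norm_smul, norm_div, Real.norm_of_nonneg hε.le, norm_norm, div_mul_cancel₀ _ hkn.ne']
  have hseg : ∀ τ ∈ Icc (0 : ℝ) 1, x + τ • h ∈ closedBall x ε := fun τ hτ => by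
    rw [mem_closedBall, dist_eq_norm, add_sub_cancel_left, norm_smul, Real.norm_of_nonneg hτ.1, hh]
    nlinarith [hτ.2, hε]
  have hb := norm_fderiv_apply_le_of_segment hf x h (h0 x (mem_closedBall_self hε.le))
    (by simpa using h0 _ (hseg 1 ⟨zero_le_one, le_rfl⟩)) (fun τ hτ => h2 _ (hseg τ hτ))
  rw [hh] at hb
  have hfk : fderiv ℝ f x k = (‖k‖ / ε) • fderiv ℝ f x h := by
    rw [← map_smul, hh_def, smul_smul, div_mul_div_comm, mul_comm ‖k‖ ε, div_self (by positivity), one_smul]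
  calc ‖fderiv ℝ f x k‖ = (‖k‖ / ε) * ‖fderiv ℝ f x h‖ := by
        rw [hfk, norm_smul, Real.norm_of_nonneg (by positivity)]
    _ ≤ (‖k‖ / ε) * (2 * A + S * ε ^ 2) := mul_le_mul_of_nonneg_left hb (by positivity)
    _ = (2 * A / ε + S * ε) * ‖k‖ := by
        field_simp

/-! ## The rung -/

/-- **«Zero-scar apex rigidity» (text of `ZeroScarApexRigidity`, nsreg-p1 `r17/Sketch18.lean`, verbatim), PROVED**: a
door-class profile with the cubic contact `‖v(t,y)‖ ≤ K(−t)/‖y‖³` to the ZERO cone off the apex is not backward-singular. -/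
theorem zeroScarApexRigidity :
  ∀ (C D K : ℝ) (v : ℝ → (EuclideanSpace ℝ (Fin 3)) → (EuclideanSpace ℝ (Fin 3))),
  HasTypeITimeDecay C v →
  HasTypeIDecay D v →
  ContinuousOn (Function.uncurry v) (Set.Iio (0 : ℝ) ×ˢ Set.univ) →
  (∀ s t : ℝ, s < t → t < 0 → ∀ x, v t x =
    UnboundedOperators.heatExtension (v s) (t - s) x - oseenDuhamel 1 s v v t x) →
  (∀ t < 0, VectorCalculus.IsDivFree (v t)) →
  (∀ t < 0, ∀ y : (EuclideanSpace ℝ (Fin 3)), y ≠ 0 → ‖v t y‖ ≤ K * (-t) / ‖y‖ ^ 3) →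
  ¬ IsBackwardSingularPoint v 0 := by
  intro C D K v hrate hdec hcont hmild hdiv hsc
  -- ### one positive constant for the class
  set C' : ℝ := max (max C D) 1 with hC'def
  have hC' : 0 < C' := lt_of_lt_of_le one_pos (le_max_right _ _)
  have hCC' : C ≤ C' := (le_max_left _ _).trans (le_max_left _ _)
  have hDC' : D ≤ C' := (le_max_right _ _).trans (le_max_left _ _)
  have hrate' : HasTypeITimeDecay C' v := fun t ht x =>
    (hrate t ht x).trans (div_le_div_of_nonneg_right hCC' (Real.sqrt_nonneg _))
  have hdec' : HasTypeIDecay C' v := fun t ht x =>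
    (hdec t ht x).trans (div_le_div_of_nonneg_right hDC' (by positivity))
  have hK : IsTypeIAncientMild C' v := isTypeIAncientMild_of_class hrate' hcont hmild hdiv
  -- ### the Albritton–Barker slab profile with `𝐈 < ∞`
  obtain ⟨Q, hsw, hwg, hI⟩ := exists_pressure_typeIBound_lt_top hC' hK hdec'
  have hapex : ∀ᵐ z ∂(volume.restrict (Iio (0 : ℝ) ×ˢ (univ : Set (EuclideanSpace ℝ (Fin 3))))),
      ‖v z.1 z.2‖ ≤ C' / (‖z.2‖ + Real.sqrt (-z.1)) := by
    filter_upwards [ae_restrict_mem (measurableSet_Iio.prod MeasurableSet.univ)] with z hz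
    exact hdec' z.1 hz.1 z.2
  -- ### the half-space `{⟪x, e₀⟫ > 0}` and the continuous representative `v` itself
  set e : (EuclideanSpace ℝ (Fin 3)) := EuclideanSpace.single 0 1 with hedef
  have he : ‖e‖ = 1 := by simp [hedef]
  refine not_isBackwardSingularPoint_of_topCurlVanishing_halfspace hsw hwg hI hapex he (Uc := v)
    Filter.EventuallyEq.rfl (hcont.mono (prod_mono Ioo_subset_Iio_self (subset_univ _))) ?_
  -- ### `curl v(s,·) → 0` locally uniformly off the apex: Landau interpolation at scale `√(−s)`
  intro x₁ hx₁ θ hθ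
  have hx₁0 : x₁ ≠ 0 := by
    rintro rfl
    simp at hx₁
  set r : ℝ := ‖x₁‖ with hrdef
  have hr : 0 < r := norm_pos_iff.2 hx₁0
  -- constants
  set Kp : ℝ := max K 0 with hKpdef
  have hKp : 0 ≤ Kp := le_max_right _ _
  have hKKp : K ≤ Kp := le_max_left _ _
  obtain ⟨K₂, hK₂0, hK₂⟩ := IsTypeIAncientMild.exists_forall_norm_iteratedFDeriv_le_of_hasTypeIDecay 2 C'
  set S : ℝ := K₂ * ((r / 2)⁻¹) ^ 3 with hSdef
  have hS : 0 ≤ S := by positivity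
  set B : ℝ := ‖curlCLM‖ * (16 * Kp / r ^ 3 + S) with hBdef
  have hB : 0 ≤ B := by positivity
  set η : ℝ := θ / (B + 1) with hηdef
  have hη : 0 < η := by positivity
  set m : ℝ := min 1 (min (r ^ 2 / 16) (η ^ 2)) with hmdef
  have hm : 0 < m := lt_min one_pos (lt_min (by positivity) (by positivity))
  refine ⟨-m, r / 4, by linarith, by linarith [min_le_left (1 : ℝ) (min (r ^ 2 / 16) (η ^ 2))],
    by positivity, fun s hs x hx => ?_⟩
  -- the scale `ε = √(−s)` and its size
  have hs0 : s < 0 := hs.2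
  have hns : 0 < -s := neg_pos.2 hs0
  have hsm : -s < m := by linarith [hs.1]
  set ε : ℝ := Real.sqrt (-s) with hεdef
  have hε : 0 < ε := Real.sqrt_pos.2 hns
  have hε2 : ε ^ 2 = -s := Real.sq_sqrt hns.le
  have hεr : ε < r / 4 := by
    have h1 : -s < r ^ 2 / 16 := hsm.trans_le ((min_le_right _ _).trans (min_le_left _ _))
    have h2 : Real.sqrt (-s) < Real.sqrt (r ^ 2 / 16) := Real.sqrt_lt_sqrt hns.le h1
    rwa [show r ^ 2 / 16 = (r / 4) ^ 2 by ring, Real.sqrt_sq (by positivity)] at h2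
  have hεη : ε < η := by
    have h1 : -s < η ^ 2 := hsm.trans_le ((min_le_right _ _).trans (min_le_right _ _))
    have h2 : Real.sqrt (-s) < Real.sqrt (η ^ 2) := Real.sqrt_lt_sqrt hns.le h1
    rwa [Real.sqrt_sq hη.le] at h2
  -- points of `B̄(x, ε)` stay at distance `≥ r/2` from the apex
  have hfar : ∀ z ∈ closedBall x ε, r / 2 ≤ ‖z‖ := by
    intro z hz
    rw [mem_closedBall, dist_eq_norm] at hz
    rw [mem_ball, dist_eq_norm] at hx
    have h1 : ‖x₁‖ ≤ ‖z‖ + ‖x₁ - z‖ := by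
      calc ‖x₁‖ = ‖z + (x₁ - z)‖ := by congr 1; abel
        _ ≤ ‖z‖ + ‖x₁ - z‖ := norm_add_le _ _
    have h2 : ‖x₁ - z‖ ≤ ‖x - x₁‖ + ‖z - x‖ := by
      calc ‖x₁ - z‖ = ‖-(x - x₁) + -(z - x)‖ := by congr 1; abel
        _ ≤ ‖-(x - x₁)‖ + ‖-(z - x)‖ := norm_add_le _ _
        _ = ‖x - x₁‖ + ‖z - x‖ := by rw [norm_neg, norm_neg]
    linarith
  have hfar0 : ∀ z ∈ closedBall x ε, z ≠ 0 := fun z hz h0 => by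
    have := hfar z hz
    rw [h0, norm_zero] at this
    linarith
  -- the smooth slice
  have hf : ContDiff ℝ 2 (v s) := (hK.contDiff_slice hs0).of_le (by norm_cast)
  -- sup bound on the ball: `‖v(s,z)‖ ≤ 8 K⁺ (−s)/r³ =: A`
  set A : ℝ := 8 * Kp * ε ^ 2 / r ^ 3 with hAdef
  have hA : 0 ≤ A := by positivity
  have h0 : ∀ z ∈ closedBall x ε, ‖v s z‖ ≤ A := by
    intro z hz
    have hz2 := hfar z hz
    have hzpos : 0 < ‖z‖ := lt_of_lt_of_le (by positivity) hz2
    calc ‖v s z‖ ≤ K * (-s) / ‖z‖ ^ 3 := hsc s hs0 z (hfar0 z hz)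
      _ ≤ Kp * (-s) / ‖z‖ ^ 3 := by gcongr
      _ ≤ Kp * (-s) / (r / 2) ^ 3 := by
          apply div_le_div_of_nonneg_left (by positivity) (by positivity)
          gcongr
      _ = A := by rw [hAdef, hε2]; ring
  -- second-derivative envelope on the ball: `‖D²v(s,·)(z)‖ ≤ K₂ (r/2)⁻³ = S`
  have h2 : ∀ z ∈ closedBall x ε, ‖iteratedFDeriv ℝ 2 (v s) z‖ ≤ S := by
    intro z hz
    have hz2 := hfar z hz
    have hb := hK₂ hK hdec' s hs0 z
    refine hb.trans ?_
    rw [hSdef]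
    have hmax : r / 2 ≤ max ‖z‖ (Real.sqrt (-s)) := hz2.trans (le_max_left _ _)
    have hinv : (max ‖z‖ (Real.sqrt (-s)))⁻¹ ≤ (r / 2)⁻¹ := inv_anti₀ (by positivity) hmax
    have hinv0 : 0 ≤ (max ‖z‖ (Real.sqrt (-s)))⁻¹ := inv_nonneg.2 ((by positivity : (0:ℝ) ≤ r / 2).trans hmax)
    gcongr
  -- Landau: `‖Dv(s,x)‖ ≤ 2A/ε + Sε = (16K⁺/r³ + S) ε`
  have hD : ‖fderiv ℝ (v s) x‖ ≤ (16 * Kp / r ^ 3 + S) * ε := by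
    have h := opNorm_fderiv_le_of_closedBall hf x hε hA hS h0 h2
    refine h.trans_eq ?_
    rw [hAdef]
    field_simp
    ring
  -- the curl
  calc ‖curl (v s) x‖ ≤ ‖curlCLM‖ * ‖fderiv ℝ (v s) x‖ := norm_curl_le _ _
    _ ≤ ‖curlCLM‖ * ((16 * Kp / r ^ 3 + S) * ε) :=
        mul_le_mul_of_nonneg_left hD (ContinuousLinearMap.opNorm_nonneg curlCLM)
    _ = B * ε := by rw [hBdef]; ring
    _ ≤ B * η := mul_le_mul_of_nonneg_left hεη.le hB
    _ = θ * (B / (B + 1)) := by rw [hηdef]; ring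
    _ ≤ θ * 1 := by
        gcongr
        rw [div_le_one (by positivity)]
        linarith
    _ = θ := mul_one θ

end Summit.NavierStokesRegularity.NavierStokesRegularity.Theorems.LocalConicalFinalStateDoorZeroScarRung

end
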